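import Mathlib
import Literature.Combinatorics.Enumerative.SimionSchmidtDoubleRestrictions
import HarnessLib

/-!
# Simion–Schmidt (1985) §3 «Double restrictions», continued: Propositions 7, 8, 10 and the pair `(123, 321)`

Continuation of `SimionSchmidtDoubleRestrictions` (Lemma 5, Propositions 9, 11) on the tree's notion
`Literature.Combinatorics.Enumerative.PermContainsPattern`; `A_n(τ, ρ) = Nat.card {v : Perm (Fin n) // ¬ C v τ ∧ ¬ C v ρ}`.

* §0 word tools: `123`/`213`/`312`-sublists of the one-line word; `213`- and `312`-patterns in a word split at its
  largest letter; decreasing words; ★ splitting a `132`-avoiding arrangement at its largest letter `m` — «any entry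
  to the left of `m` is larger than any entry to the right» — and gluing back.
* §1 PROPOSITION 7 «`A_n(123, 132) = 2^{n−1}`»: as printed, if `σ(k) = n` then `σ(i) = n − i` for `i < k` and the rest
  is a `(123, 132)`-avoiding permutation of `S_{n−k}`: `A_n = 1 + Σ_{k=1}^{n−1} A_{n−k}`.  With Lemma 5 (a) the same
  value for `(123, 213)`, `(231, 321)`, `(312, 321)`.
* §2 PROPOSITION 8 «`A_n(132, 213) = 2^{n−1}`»: `σ(i) = n − k + i` for `i ≤ k` is forced; same recurrence.  With
  Lemma 5 (b), `(231, 312)`.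
* §3 PROPOSITION 10 «`A_n(132, 312) = 2^{n−1}`»: the letters before `n` form a `(132, 312)`-avoider on the `k − 1`
  largest remaining letters, the letters after `n` decrease.  With Lemma 5 (d), `(213, 231)`.
* §4 «and `0` (case `R = {123, 321}`, for `n ≥ 5`)»: every permutation of length `≥ 5` contains `123` or `321`.
(In `ℕ`, `2 ^ (0 − 1) = 1 = A_0`, so the closed forms hold for every `n`.)

## References
* [SimionSchmidt1985] R. Simion, F. W. Schmidt, Restricted permutations, European J. Combin. 6 (1985) 383–406, §3:
  Lemma 5, Propositions 7, 8, 10, the summary before Proposition 7 (held text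
  `paper:doi-10-1016-s0195-6698-85-80052-4`, p0010–p0012).
* [Bona2012] M. Bóna, Combinatorics of Permutations, 2nd ed., CRC Press 2012, Definition 4.1, §4.2 (held text
  p0128–p0131).
-/

namespace Literature.Combinatorics.Enumerative

namespace PermContainsPattern

open Finset Equiv

/-! ### §0 Word tools -/

section WordTools

variable {α : Type*} {n : ℕ}

/-- The one-line word of `v` has a `123`-sublist iff `v` contains `123`. [cite: SimionSchmidt1985, §1 (held text p0002)] -/
theorem has123_ofFn_perm_iff (v : Perm (Fin n)) :
    (∃ a b c : ℕ, [a, b, c].Sublist (List.ofFn fun i => (v i : ℕ)) ∧ a < b ∧ b < c) ↔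
      PermContainsPattern v ![1, 2, 3] := by
  rw [contains_123_iff]
  refine (exists_three_sublist_ofFn_iff _ (fun a b c => a < b ∧ b < c)).trans ?_
  simp only [Fin.val_fin_lt]

/-- The one-line word of `v` has a `213`-sublist (`a b c` with `b < a < c`) iff `v` contains `213`.
[cite: SimionSchmidt1985, §1 (held text p0002)] -/
theorem has213_ofFn_perm_iff (v : Perm (Fin n)) :
    (∃ a b c : ℕ, [a, b, c].Sublist (List.ofFn fun i => (v i : ℕ)) ∧ b < a ∧ a < c) ↔
      PermContainsPattern v ![2, 1, 3] := by
  rw [contains_213_iff]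
  refine (exists_three_sublist_ofFn_iff _ (fun a b c => b < a ∧ a < c)).trans ?_
  simp only [Fin.val_fin_lt]

/-- The one-line word of `v` has a `312`-sublist (`a b c` with `b < c < a`) iff `v` contains `312`.
[cite: SimionSchmidt1985, §1 (held text p0002)] -/
theorem has312_ofFn_perm_iff (v : Perm (Fin n)) :
    (∃ a b c : ℕ, [a, b, c].Sublist (List.ofFn fun i => (v i : ℕ)) ∧ b < c ∧ c < a) ↔
      PermContainsPattern v ![3, 1, 2] := by
  rw [contains_312_iff]
  refine (exists_three_sublist_ofFn_iff _ (fun a b c => b < c ∧ c < a)).trans ?_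
  simp only [Fin.val_fin_lt]

/-- A duplicate-free list enumerating a finset `T` has `#T` entries. [folklore] -/
private theorem length_eq_card_of_mem_iff' [DecidableEq α] {l : List α} {T : Finset α} (hn : l.Nodup)
    (h : ∀ x, x ∈ l ↔ x ∈ T) : l.length = T.card := by
  rw [← List.toFinset_card_of_nodup hn]
  congr 1
  ext x
  rw [List.mem_toFinset, h]

omit n in
/-- Lists: `l₁ ++ m :: l₂ = l₁' ++ m :: l₂'` with `m ∉ l₁, l₁'` forces `l₁ = l₁'` and `l₂ = l₂'`. [folklore] -/
private theorem append_cons_inj_of_notMem' {m : α} :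
    ∀ {l₁ l₁' l₂ l₂' : List α}, m ∉ l₁ → m ∉ l₁' → l₁ ++ m :: l₂ = l₁' ++ m :: l₂' → l₁ = l₁' ∧ l₂ = l₂'
  | [], [], _, _, _, _, h => by simpa using h
  | [], x :: l₁', _, _, _, h', h => by
    simp only [List.nil_append, List.cons_append, List.cons.injEq] at h
    exact absurd (h.1 ▸ List.mem_cons_self) h'
  | x :: l₁, [], _, _, h', _, h => by
    simp only [List.nil_append, List.cons_append, List.cons.injEq] at h
    exact absurd (h.1 ▸ List.mem_cons_self) h'
  | x :: l₁, x' :: l₁', l₂, l₂', h₁, h₁', h => by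
    simp only [List.cons_append, List.cons.injEq] at h
    obtain ⟨rfl, h⟩ := h
    have ih := append_cons_inj_of_notMem' (List.not_mem_of_not_mem_cons h₁) (List.not_mem_of_not_mem_cons h₁') h
    exact ⟨by rw [ih.1], ih.2⟩

/-- `Σ_{j=0}^{n} 2^{j−1} = 2^n` in `ℕ` (the term `j = 0` is `2^{0−1} = 1`): the printed recurrence
`A_n = 1 + Σ_{k=1}^{n−1} A_{n−k}` solves to `2^{n−1}`. [cite: SimionSchmidt1985, Proposition 7 (proof, held text p0011)] -/
theorem sum_range_succ_two_pow_pred (n : ℕ) : ∑ j ∈ Finset.range (n + 1), 2 ^ (j - 1) = 2 ^ n := by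
  induction n with
  | zero => simp
  | succ n ih => rw [Finset.sum_range_succ, ih, Nat.add_sub_cancel, pow_succ]; ring

variable [LinearOrder α]

/-- Reversal on words: `l` has a `312`-sublist iff the reversed word has a `213`-sublist.
[cite: SimionSchmidt1985, Lemma 1 (held text p0002)] -/
theorem has312_iff_has213_reverse (l : List α) :
    (∃ a b c : α, [a, b, c].Sublist l ∧ b < c ∧ c < a) ↔
      ∃ a b c : α, [a, b, c].Sublist l.reverse ∧ b < a ∧ a < c := by
  constructor
  · rintro ⟨a, b, c, hs, hbc, hca⟩
    exact ⟨c, b, a, by simpa using hs.reverse, hbc, hca⟩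
  · rintro ⟨a, b, c, hs, hba, hac⟩
    exact ⟨c, b, a, by simpa using hs.reverse, hba, hac⟩

/-- A `213`-pattern in `l₁ m l₂` (`m` the largest letter) lies in `l₂`, or ends with `m` (a descent `a b` of `l₁`, then
`m`), or is `x b c` with `x ∈ l₁` and an ascent `b c` of `l₂` around `x` (`b < x < c`); and conversely.
[cite: SimionSchmidt1985, Proposition 8 (proof, held text p0011)] -/
theorem has213_append_max_iff (l₁ l₂ : List α) (m : α) (hm₁ : ∀ x ∈ l₁, x < m) (hm₂ : ∀ y ∈ l₂, y < m) :
    (∃ a b c : α, [a, b, c].Sublist (l₁ ++ m :: l₂) ∧ b < a ∧ a < c) ↔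
      (∃ a b c : α, [a, b, c].Sublist l₂ ∧ b < a ∧ a < c) ∨ (∃ a b : α, [a, b].Sublist l₁ ∧ b < a) ∨
        (∃ x ∈ l₁, ∃ b c : α, [b, c].Sublist l₂ ∧ b < x ∧ x < c) := by
  constructor
  · rintro ⟨a, b, c, hs, hba, hac⟩
    rw [List.sublist_append_iff] at hs
    obtain ⟨k₁, k₂, hk, h₁, h₂⟩ := hs
    rcases k₁ with _ | ⟨x, _ | ⟨y, _ | ⟨z, k₁⟩⟩⟩
    · -- `k₁ = []`, `[a, b, c] <+ m :: l₂`
      simp only [List.nil_append] at hk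
      subst hk
      rcases List.sublist_cons_iff.mp h₂ with h₂ | ⟨r, hr, hr₂⟩
      · exact Or.inl ⟨a, b, c, h₂, hba, hac⟩
      · simp only [List.cons.injEq] at hr
        obtain ⟨rfl, rfl⟩ := hr
        have hc : c ∈ l₂ := hr₂.subset (by simp)
        exact absurd (hm₂ c hc) (not_lt.mpr hac.le)
    · -- `k₁ = [a] <+ l₁`, `[b, c] <+ m :: l₂`
      simp only [List.cons_append, List.nil_append, List.cons.injEq] at hk
      have ha : a ∈ l₁ := hk.1 ▸ h₁.subset (List.mem_singleton_self x)
      have h₂' : [b, c].Sublist (m :: l₂) := hk.2 ▸ h₂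
      rcases List.sublist_cons_iff.mp h₂' with h₃ | ⟨r, hr, -⟩
      · exact Or.inr (Or.inr ⟨a, ha, b, c, h₃, hba, hac⟩)
      · simp only [List.cons.injEq] at hr
        exact absurd ((hm₁ a ha).trans (hr.1 ▸ hba)) (lt_irrefl a)
    · -- `k₁ = [a, b] <+ l₁`
      simp only [List.cons_append, List.nil_append, List.cons.injEq] at hk
      exact Or.inr (Or.inl ⟨a, b, hk.1 ▸ hk.2.1 ▸ h₁, hba⟩)
    · -- `k₁ = [a, b, c] <+ l₁`
      have hk' : k₁ = [] ∧ k₂ = [] := by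
        have hl := congrArg List.length hk
        simp only [List.length_cons, List.length_append, List.length_nil] at hl
        constructor <;> exact List.eq_nil_of_length_eq_zero (by omega)
      obtain ⟨rfl, rfl⟩ := hk'
      simp only [List.cons_append, List.nil_append, List.cons.injEq, and_true] at hk
      have h₁' : [a, b, c].Sublist l₁ := hk.1 ▸ hk.2.1 ▸ hk.2.2 ▸ h₁
      exact Or.inr (Or.inl ⟨a, b, (List.cons_sublist_cons.mpr (List.cons_sublist_cons.mpr
        (List.nil_sublist [c]))).trans h₁', hba⟩)
  · rintro (⟨a, b, c, hs, hba, hac⟩ | ⟨a, b, hs, hba⟩ | ⟨x, hx, b, c, hs, hbx, hxc⟩)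
    · exact ⟨a, b, c, (hs.trans (List.sublist_cons_self m l₂)).trans (List.sublist_append_right l₁ (m :: l₂)),
        hba, hac⟩
    · refine ⟨a, b, m, ?_, hba, hm₁ a (hs.subset (by simp))⟩
      have h2 : [m].Sublist (m :: l₂) := List.singleton_sublist.mpr List.mem_cons_self
      exact hs.append h2
    · refine ⟨x, b, c, ?_, hbx, hxc⟩
      have h1 : [x].Sublist l₁ := List.singleton_sublist.mpr hx
      exact h1.append (hs.trans (List.sublist_cons_self m l₂))

/-- A `312`-pattern in `l₁ m l₂` (`m` the largest letter) lies in `l₁`, or starts with `m` (then an ascent `a b` of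
`l₂`), or is a descent-around: `a b` in `l₁` and `y ∈ l₂` with `b < y < a`; and conversely.
[cite: SimionSchmidt1985, Proposition 10 (proof, held text p0011)] -/
theorem has312_append_max_iff (l₁ l₂ : List α) (m : α) (hm₁ : ∀ x ∈ l₁, x < m) (hm₂ : ∀ y ∈ l₂, y < m) :
    (∃ a b c : α, [a, b, c].Sublist (l₁ ++ m :: l₂) ∧ b < c ∧ c < a) ↔
      (∃ a b c : α, [a, b, c].Sublist l₁ ∧ b < c ∧ c < a) ∨ (∃ a b : α, [a, b].Sublist l₂ ∧ a < b) ∨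
        (∃ y ∈ l₂, ∃ a b : α, [a, b].Sublist l₁ ∧ b < y ∧ y < a) := by
  rw [has312_iff_has213_reverse, has312_iff_has213_reverse l₁]
  have e : (l₁ ++ m :: l₂).reverse = l₂.reverse ++ m :: l₁.reverse := by simp
  rw [e, has213_append_max_iff l₂.reverse l₁.reverse m (fun y hy => hm₂ y (List.mem_reverse.mp hy))
    (fun x hx => hm₁ x (List.mem_reverse.mp hx))]
  refine or_congr_right (or_congr ⟨?_, ?_⟩ ⟨?_, ?_⟩)
  · rintro ⟨a, b, hs, hba⟩
    exact ⟨b, a, by simpa using hs.reverse, hba⟩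
  · rintro ⟨a, b, hs, hab⟩
    exact ⟨b, a, by simpa using hs.reverse, hab⟩
  · rintro ⟨x, hx, b, c, hs, hbx, hxc⟩
    exact ⟨x, List.mem_reverse.mp hx, c, b, by simpa using hs.reverse, hbx, hxc⟩
  · rintro ⟨y, hy, a, b, hs, hby, hya⟩
    exact ⟨y, List.mem_reverse.mpr hy, b, a, by simpa using hs.reverse, hby, hya⟩

/-- A decreasing word has no ascent. [cite: SimionSchmidt1985, Proposition 7 (proof, held text p0011)] -/
theorem not_has12_of_pairwise_gt {l : List α} (h : l.Pairwise (fun a b => b < a)) :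
    ¬ ∃ a b : α, [a, b].Sublist l ∧ a < b := by
  rintro ⟨a, b, hs, hab⟩
  exact absurd (List.pairwise_iff_forall_sublist.mp h hs) (not_lt.mpr hab.le)

/-- A decreasing word has no `132`-sublist. [cite: SimionSchmidt1985, Proposition 7 (proof, held text p0011)] -/
theorem not_has132_of_pairwise_gt {l : List α} (h : l.Pairwise (fun a b => b < a)) :
    ¬ ∃ a b c : α, [a, b, c].Sublist l ∧ a < c ∧ c < b := by
  rintro ⟨a, b, c, hs, hac, -⟩
  exact absurd (List.pairwise_iff_forall_sublist.mp h
    ((List.cons_sublist_cons.mpr (List.sublist_cons_self b [c])).trans hs)) (not_lt.mpr hac.le)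

/-- An increasing word has no `213`-sublist. [cite: SimionSchmidt1985, Proposition 8 (proof, held text p0011)] -/
theorem not_has213_of_pairwise_lt {l : List α} (h : l.Pairwise (· < ·)) :
    ¬ ∃ a b c : α, [a, b, c].Sublist l ∧ b < a ∧ a < c := by
  rintro ⟨a, b, c, hs, hba, -⟩
  exact absurd (List.pairwise_iff_forall_sublist.mp h ((List.cons_sublist_cons.mpr
    (List.cons_sublist_cons.mpr (List.nil_sublist [c]))).trans hs)) (not_lt.mpr hba.le)

/-- A duplicate-free word with no ascent is decreasing. [cite: SimionSchmidt1985, Proposition 7 (proof, held text p0011)] -/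
theorem pairwise_gt_of_not_has12 {l : List α} (hn : l.Nodup) (h : ¬ ∃ a b : α, [a, b].Sublist l ∧ a < b) :
    l.Pairwise (fun a b => b < a) :=
  List.pairwise_iff_forall_sublist.mpr fun {a b} hs =>
    lt_of_le_of_ne (not_lt.mp fun hab => h ⟨a, b, hs, hab⟩) fun hba => by
      have := hn.sublist hs
      simp [hba] at this

/-- The decreasing arrangement of a finset is its only decreasing arrangement.
[cite: SimionSchmidt1985, Proposition 7 (proof, held text p0011)] -/
theorem eq_reverse_sort_of_pairwise_gt {l : List α} {T : Finset α} (h : l.Pairwise (fun a b => b < a))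
    (hmem : ∀ x, x ∈ l ↔ x ∈ T) : l = (T.sort : List α).reverse := by
  have h' : l.reverse.Pairwise (· < ·) := List.pairwise_reverse.mpr h
  rw [← eq_sort_of_pairwise_lt h' (fun x => by rw [List.mem_reverse, hmem]), List.reverse_reverse]

/-- The decreasing arrangement of `T` decreases. [cite: SimionSchmidt1985, Proposition 7 (proof, held text p0011)] -/
theorem pairwise_gt_reverse_sort (T : Finset α) : ((T.sort : List α).reverse).Pairwise (fun a b => b < a) :=
  List.pairwise_reverse.mpr (T.sortedLT_sort).pairwise

/-- ★ **Splitting at the largest letter** «any entry to the left of `n` must be larger than any entry to the right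
of `n`»: a `132`-avoiding arrangement `l` of `T ∪ {m}` (`m` above `T`) is `l₁ m l₂` with `l₂` an arrangement of the
`|l₂|` smallest letters of `T`, `l₁` an arrangement of the others, and `l₂` below `l₁`.
[cite: Bona2012, Theorem 4.7 (proof, held text p0131)] -/
theorem exists_split_at_max (T : Finset α) {m : α} (hm : ∀ x ∈ T, x < m) {l : List α} (hnd : l.Nodup)
    (hmem : ∀ x, x ∈ l ↔ x = m ∨ x ∈ T) (h132 : ¬ ∃ a b c : α, [a, b, c].Sublist l ∧ a < c ∧ c < b) :
    ∃ l₁ l₂ : List α, l = l₁ ++ m :: l₂ ∧ l₁.Nodup ∧ l₂.Nodup ∧ l₂.length ≤ T.card ∧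
      (∀ y, y ∈ l₂ ↔ y ∈ T.filter (fun x => (T.filter (· < x)).card < l₂.length)) ∧
      (∀ x, x ∈ l₁ ↔ x ∈ T \ T.filter (fun x => (T.filter (· < x)).card < l₂.length)) ∧
      (∀ x ∈ l₁, x < m) ∧ (∀ y ∈ l₂, y < m) ∧ (∀ x ∈ l₁, ∀ y ∈ l₂, y < x) := by
  have hmT : m ∉ T := fun h => lt_irrefl m (hm m h)
  obtain ⟨l₁, l₂, rfl⟩ := List.append_of_mem ((hmem m).mpr (Or.inl rfl))
  have hnd' := hnd
  rw [List.nodup_append] at hnd'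
  obtain ⟨hn₁, hn₂', hdis⟩ := hnd'
  rw [List.nodup_cons] at hn₂'
  obtain ⟨hm₂, hn₂⟩ := hn₂'
  have hm₁ : m ∉ l₁ := fun h => (hdis m h m List.mem_cons_self) rfl
  have hT₁ : ∀ x ∈ l₁, x ∈ T := fun x hx => by
    rcases (hmem x).mp (List.mem_append.mpr (Or.inl hx)) with rfl | h
    · exact absurd hx hm₁
    · exact h
  have hT₂ : ∀ y ∈ l₂, y ∈ T := fun y hy => by
    rcases (hmem y).mp (List.mem_append.mpr (Or.inr (List.mem_cons_of_mem m hy))) with rfl | h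
    · exact absurd hy hm₂
    · exact h
  have hm₁' : ∀ x ∈ l₁, x < m := fun x hx => hm x (hT₁ x hx)
  have hm₂' : ∀ y ∈ l₂, y < m := fun y hy => hm y (hT₂ y hy)
  have hbelow : ∀ x ∈ l₁, ∀ y ∈ l₂, y < x := fun x hx y hy =>
    lt_of_le_of_ne (not_lt.mp fun hxy => h132 ((has132_append_max_iff l₁ l₂ m hm₁' hm₂').mpr
      (Or.inr (Or.inr ⟨x, hx, y, hy, hxy⟩)))) fun h => hdis x hx y (List.mem_cons_of_mem m hy) h.symm
  have hsplit' : ∀ x, x ∈ T ↔ x ∈ l₁.toFinset ∨ x ∈ l₂.toFinset := fun x => by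
    rw [List.mem_toFinset, List.mem_toFinset]
    constructor
    · intro hx
      rcases List.mem_append.mp ((hmem x).mpr (Or.inr hx)) with h | h
      · exact Or.inl h
      · rcases List.mem_cons.mp h with rfl | h
        · exact absurd hx hmT
        · exact Or.inr h
    · rintro (hx | hx)
      · exact hT₁ x hx
      · exact hT₂ x hx
  have hB := eq_filter_rank_lt_of_forall_lt T l₁.toFinset l₂.toFinset hsplit' fun x hx y hy =>
    hbelow x (List.mem_toFinset.mp hx) y (List.mem_toFinset.mp hy)
  rw [List.toFinset_card_of_nodup hn₂] at hB
  have hlen : l₂.length ≤ T.card := by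
    rw [← List.toFinset_card_of_nodup hn₂]
    exact Finset.card_le_card fun y hy => hT₂ y (List.mem_toFinset.mp hy)
  refine ⟨l₁, l₂, rfl, hn₁, hn₂, hlen, fun y => ?_, fun x => ?_, hm₁', hm₂', hbelow⟩
  · rw [← hB, List.mem_toFinset]
  · rw [Finset.mem_sdiff, ← hB, List.mem_toFinset]
    constructor
    · intro hx
      exact ⟨hT₁ x hx, fun hx' => hdis x hx x (List.mem_cons_of_mem m hx') rfl⟩
    · rintro ⟨hx, hx'⟩
      rcases (hsplit' x).mp hx with h | h
      · exact List.mem_toFinset.mp h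
      · exact absurd (List.mem_toFinset.mp h) hx'

/-- ★ **Gluing at the largest letter**: an arrangement `l₂` of the `j` smallest letters of `T` and an arrangement `l₁`
of the others give an arrangement `l₁ m l₂` of `T ∪ {m}` with `l₂` below `l₁` below `m`.
[cite: Bona2012, Theorem 4.7 (proof, held text p0131)] -/
theorem glue_at_max (T : Finset α) {m : α} (hm : ∀ x ∈ T, x < m) (j : ℕ) {l₁ l₂ : List α} (hn₁ : l₁.Nodup)
    (hn₂ : l₂.Nodup) (h₂ : ∀ y, y ∈ l₂ ↔ y ∈ T.filter (fun x => (T.filter (· < x)).card < j))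
    (h₁ : ∀ x, x ∈ l₁ ↔ x ∈ T \ T.filter (fun x => (T.filter (· < x)).card < j)) :
    (l₁ ++ m :: l₂).Nodup ∧ (∀ x, x ∈ l₁ ++ m :: l₂ ↔ x = m ∨ x ∈ T) ∧
      (∀ x ∈ l₁, x < m) ∧ (∀ y ∈ l₂, y < m) ∧ (∀ x ∈ l₁, ∀ y ∈ l₂, y < x) := by
  have hmT : m ∉ T := fun h => lt_irrefl m (hm m h)
  set L := T.filter (fun x => (T.filter (· < x)).card < j) with hL
  have hsub : L ⊆ T := Finset.filter_subset _ _
  have h₁' : ∀ x ∈ l₁, x ∈ T ∧ x ∉ L := fun x hx => Finset.mem_sdiff.mp ((h₁ x).mp hx)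
  have h₂' : ∀ y ∈ l₂, y ∈ L := fun y hy => (h₂ y).mp hy
  have hm₁ : ∀ x ∈ l₁, x < m := fun x hx => hm x (h₁' x hx).1
  have hm₂ : ∀ y ∈ l₂, y < m := fun y hy => hm y (hsub (h₂' y hy))
  have hbelow : ∀ x ∈ l₁, ∀ y ∈ l₂, y < x := fun x hx y hy =>
    lt_of_mem_filter_rank_lt_of_not_mem T j (h₂' y hy) (h₁' x hx).1 (h₁' x hx).2
  refine ⟨?_, fun x => ?_, hm₁, hm₂, hbelow⟩
  · rw [List.nodup_append]
    refine ⟨hn₁, List.nodup_cons.mpr ⟨fun h => hmT (hsub (h₂' m h)), hn₂⟩, fun x hx y hy => ?_⟩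
    rcases List.mem_cons.mp hy with rfl | hy
    · exact (hm₁ x hx).ne
    · exact (hbelow x hx y hy).ne'
  · rw [List.mem_append, List.mem_cons, h₁ x, h₂ x, Finset.mem_sdiff]
    constructor
    · rintro (⟨hx, -⟩ | rfl | hx)
      · exact Or.inr hx
      · exact Or.inl rfl
      · exact Or.inr (hsub hx)
    · rintro (rfl | hx)
      · exact Or.inr (Or.inl rfl)
      · by_cases h : x ∈ L
        · exact Or.inr (Or.inr h)
        · exact Or.inl ⟨hx, h⟩

end WordTools

/-! ### §1 PROPOSITION 7 — `A_n(123, 132) = 2^{n−1}` -/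

section Prop7

variable {α : Type*} [LinearOrder α]

/-- ★★ **Proposition 7 on words.** The arrangements of a finite set `S` of letters with no `123`- and no `132`-sublist
number `2^{#S − 1}`: split an avoider at its largest letter `m` as `l₁ m l₂`; then `l₂` consists of the `|l₂|` smallest
letters (no `132`) and is again an avoider, while `l₁` decreases (an ascent of `l₁` followed by `m` is a `123`) — «`σ(i) =
n − i` for `1 ≤ i ≤ k − 1`» — so `A_n = Σ_{j=0}^{n−1} A_j = 1 + Σ_{k=1}^{n−1} A_{n−k} = 2^{n−1}`.
[cite: SimionSchmidt1985, Proposition 7 (held text p0010–p0011)] -/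
theorem card_arrangements_not123_not132
    [DecidablePred fun l : List α => (¬ ∃ a b c : α, [a, b, c].Sublist l ∧ a < b ∧ b < c) ∧
      ¬ ∃ a b c : α, [a, b, c].Sublist l ∧ a < c ∧ c < b] (S : Finset α) :
    ((Multiset.lists S.val).toFinset.filter (fun l => (¬ ∃ a b c : α, [a, b, c].Sublist l ∧ a < b ∧ b < c) ∧
      ¬ ∃ a b c : α, [a, b, c].Sublist l ∧ a < c ∧ c < b)).card = 2 ^ (S.card - 1) := by
  set av : Finset α → Finset (List α) := fun T => (Multiset.lists T.val).toFinset.filter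
    (fun l => (¬ ∃ a b c : α, [a, b, c].Sublist l ∧ a < b ∧ b < c) ∧
      ¬ ∃ a b c : α, [a, b, c].Sublist l ∧ a < c ∧ c < b) with hav
  have hmem_av : ∀ (T : Finset α) (l : List α), l ∈ av T ↔ (l.Nodup ∧ ∀ x, x ∈ l ↔ x ∈ T) ∧
      (¬ ∃ a b c : α, [a, b, c].Sublist l ∧ a < b ∧ b < c) ∧ ¬ ∃ a b c : α, [a, b, c].Sublist l ∧ a < c ∧ c < b :=
    fun T l => by simp only [hav, Finset.mem_filter, mem_lists_toFinset_iff]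
  have hav_empty : av ∅ = {[]} := by
    simp only [hav, lists_toFinset_empty]
    rw [Finset.filter_singleton, if_pos ⟨by rintro ⟨a, b, c, h, -⟩; simp at h, by rintro ⟨a, b, c, h, -⟩; simp at h⟩]
  change (av S).card = 2 ^ (S.card - 1)
  induction' hn : S.card using Nat.strong_induction_on with n ih generalizing S
  rcases n with _ | n
  · rw [Finset.card_eq_zero.mp hn, hav_empty, Finset.card_singleton]
    norm_num
  -- `S` has `n + 1` letters, the largest is `m`, `S' = S \ {m}` has `n`
  have hS : S.Nonempty := Finset.card_pos.mp (by omega)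
  set m := S.max' hS with hm
  set S' := S.erase m with hS'def
  have hmS : m ∈ S := Finset.max'_mem S hS
  have hS' : S'.card = n := by rw [hS'def, Finset.card_erase_of_mem hmS, hn]; rfl
  have hltm : ∀ x ∈ S', x < m := fun x hx => Finset.lt_max'_of_mem_erase_max' S hS hx
  have hmemS : ∀ x, x ∈ S ↔ x = m ∨ x ∈ S' := fun x => by
    rw [hS'def, Finset.mem_erase]
    constructor
    · intro hx
      by_cases h : x = m
      · exact Or.inl h
      · exact Or.inr ⟨h, hx⟩
    · rintro (rfl | ⟨-, hx⟩)
      · exact hmS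
      · exact hx
  -- `low j` = the `j` smallest letters of `S'`; `dec j` = the others in decreasing order
  set low : ℕ → Finset α := fun j => S'.filter (fun x => (S'.filter (· < x)).card < j) with hlow
  have hlow_card : ∀ j ≤ n, (low j).card = j := fun j hj => card_filter_rank_lt S' (by rw [hS']; exact hj)
  set dec : ℕ → List α := fun j => ((S' \ low j).sort : List α).reverse with hdec
  have hdec_mem : ∀ j x, x ∈ dec j ↔ x ∈ S' \ low j := fun j x => by
    rw [hdec, List.mem_reverse, Finset.mem_sort]
  have hdec_nodup : ∀ j, (dec j).Nodup := fun j => List.nodup_reverse.mpr (Finset.sort_nodup _ _)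
  have hdec_gt : ∀ j, (dec j).Pairwise (fun a b => b < a) := fun j => pairwise_gt_reverse_sort _
  have hmdec : ∀ j, m ∉ dec j := fun j h =>
    lt_irrefl m (hltm m (Finset.sdiff_subset ((hdec_mem j m).mp h)))
  -- the piece `j`: `dec j ++ m :: l₂`, `l₂` an avoider on `low j`
  have hpiece : ∀ j, ∀ l₂ ∈ av (low j), dec j ++ m :: l₂ ∈ av S := fun j l₂ hl₂ => by
    rw [hmem_av] at hl₂ ⊢
    obtain ⟨⟨hn₂, hmem₂⟩, h123, h132⟩ := hl₂
    obtain ⟨hnd, hmem, hm₁, hm₂, hbelow⟩ := glue_at_max S' hltm j (hdec_nodup j) hn₂ hmem₂ (hdec_mem j)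
    refine ⟨⟨hnd, fun x => by rw [hmem x, hmemS]⟩, ?_, ?_⟩
    · rw [has123_append_max_iff _ _ m hm₁ hm₂]
      rintro (h | h | ⟨x, hx, b, c, hs, hxb, -⟩)
      · exact h123 h
      · exact not_has12_of_pairwise_gt (hdec_gt j) h
      · exact absurd hxb (not_lt.mpr (hbelow x hx b (hs.subset (by simp))).le)
    · rw [has132_append_max_iff _ _ m hm₁ hm₂]
      rintro (h | h | ⟨x, hx, y, hy, hxy⟩)
      · exact not_has132_of_pairwise_gt (hdec_gt j) h
      · exact h132 h
      · exact absurd hxy (not_lt.mpr (hbelow x hx y hy).le)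
  -- every avoider on `S` lies in the piece `j = |l₂|`
  have hsplit : ∀ l ∈ av S, ∃ j, j < n + 1 ∧ ∃ l₂ ∈ av (low j), dec j ++ m :: l₂ = l := fun l hl => by
    rw [hmem_av] at hl
    obtain ⟨⟨hnd, hmem⟩, h123, h132⟩ := hl
    obtain ⟨l₁, l₂, rfl, hn₁, hn₂, hlen, hmem₂, hmem₁, hm₁, hm₂, hbelow⟩ :=
      exists_split_at_max S' hltm hnd (fun x => by rw [hmem x, hmemS]) h132
    rw [hS'] at hlen
    refine ⟨l₂.length, by omega, l₂, ?_, ?_⟩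
    · rw [hmem_av]
      refine ⟨⟨hn₂, hmem₂⟩, fun ⟨a, b, c, hs, hh⟩ => h123 ⟨a, b, c, ?_, hh⟩, fun ⟨a, b, c, hs, hh⟩ =>
        h132 ⟨a, b, c, ?_, hh⟩⟩ <;>
      exact (hs.trans (List.sublist_cons_self m l₂)).trans (List.sublist_append_right l₁ (m :: l₂))
    · -- `l₁` decreases: an ascent `a b` of `l₁` gives the `123`-pattern `a b m`
      have hgt : l₁.Pairwise (fun a b => b < a) := pairwise_gt_of_not_has12 hn₁ fun ⟨a, b, hs, hab⟩ =>
        h123 ((has123_append_max_iff l₁ l₂ m hm₁ hm₂).mpr (Or.inr (Or.inl ⟨a, b, hs, hab⟩)))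
      rw [eq_reverse_sort_of_pairwise_gt hgt hmem₁]
  have hU : av S = (Finset.range (n + 1)).biUnion (fun j => (av (low j)).image fun l₂ => dec j ++ m :: l₂) := by
    ext l
    simp only [Finset.mem_biUnion, Finset.mem_range, Finset.mem_image]
    constructor
    · exact hsplit l
    · rintro ⟨j, -, l₂, hl₂, rfl⟩
      exact hpiece j l₂ hl₂
  rw [hU, Finset.card_biUnion]
  · rw [Finset.sum_congr rfl fun j hj => ?_, sum_range_succ_two_pow_pred, Nat.add_sub_cancel]
    rw [Finset.mem_range] at hj
    rw [Finset.card_image_of_injective _ fun l l' h => List.cons_injective (List.append_cancel_left h)]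
    exact ih j (by omega) (low j) (hlow_card j (by omega))
  · -- the pieces are disjoint: the part after `m` has `j` letters
    intro j hj j' hj' hne
    rw [Finset.mem_coe, Finset.mem_range] at hj hj'
    rw [Function.onFun, Finset.disjoint_left]
    intro l hl hl'
    rw [Finset.mem_image] at hl hl'
    obtain ⟨l₂, h₂, rfl⟩ := hl
    obtain ⟨l₂', h₂', he⟩ := hl'
    have e := (append_cons_inj_of_notMem' (hmdec j') (hmdec j) he).2
    rw [hmem_av] at h₂ h₂'
    have hl2 := length_eq_card_of_mem_iff' h₂.1.1 h₂.1.2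
    have hl2' := length_eq_card_of_mem_iff' h₂'.1.1 h₂'.1.2
    rw [hlow_card j (by omega)] at hl2
    rw [hlow_card j' (by omega), e, hl2] at hl2'
    exact hne hl2'

/-- ★★★ **PROPOSITION 7 (Simion–Schmidt 1985)** «The number of `(123, 132)`-avoiding permutations in `S_n`, `n ≥ 1`,
is `A_n(123, 132) = 2^{n−1}`» (stated for every `n`; both sides are `1` at `n = 0`).
[cite: SimionSchmidt1985, Proposition 7 (held text p0010–p0011)] -/
theorem card_av123_av132 (n : ℕ) :
    Nat.card {v : Perm (Fin n) // ¬ PermContainsPattern v ![1, 2, 3] ∧ ¬ PermContainsPattern v ![1, 3, 2]} =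
      2 ^ (n - 1) := by
  classical
  refine (natCard_perm_eq_card_filter_arrangements n
    (fun v : Perm (Fin n) => ¬ PermContainsPattern v ![1, 2, 3] ∧ ¬ PermContainsPattern v ![1, 3, 2])
    (fun l : List ℕ => (¬ ∃ a b c : ℕ, [a, b, c].Sublist l ∧ a < b ∧ b < c) ∧
      ¬ ∃ a b c : ℕ, [a, b, c].Sublist l ∧ a < c ∧ c < b)
    (fun v => by rw [has123_ofFn_perm_iff, has132_ofFn_perm_iff])).trans ?_
  rw [card_arrangements_not123_not132 (α := ℕ) (Finset.range n), Finset.card_range]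

/-- PROPOSITION 7, the printed recurrence «`A_n(123, 132) = 1 + Σ_{k=1}^{n−1} A_{n−k}(123, 132)`» (`n ≥ 1`).
[cite: SimionSchmidt1985, Proposition 7 (proof, held text p0011)] -/
theorem card_av123_av132_recurrence (n : ℕ) (hn : 1 ≤ n) :
    Nat.card {v : Perm (Fin n) // ¬ PermContainsPattern v ![1, 2, 3] ∧ ¬ PermContainsPattern v ![1, 3, 2]} =
      1 + ∑ k ∈ Finset.Ico 1 n,
        Nat.card {v : Perm (Fin (n - k)) // ¬ PermContainsPattern v ![1, 2, 3] ∧ ¬ PermContainsPattern v ![1, 3, 2]} := by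
  simp_rw [card_av123_av132]
  obtain ⟨n, rfl⟩ := Nat.exists_eq_add_of_le' hn
  rw [Nat.add_sub_cancel, ← sum_range_succ_two_pow_pred, Finset.sum_range_succ', Nat.zero_sub, pow_zero, add_comm,
    Finset.sum_Ico_eq_sum_range]
  congr 1
  rw [Nat.add_sub_cancel, ← Finset.sum_range_reflect]
  refine Finset.sum_congr rfl fun k hk => ?_
  rw [Finset.mem_range] at hk
  congr 1
  omega

/-- PROPOSITION 7 with LEMMA 5 (a): `A_n(123, 213) = 2^{n−1}`. [cite: SimionSchmidt1985, Proposition 7 and Lemma 5 (a)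
(held text p0010–p0011)] -/
theorem card_av123_av213 (n : ℕ) :
    Nat.card {v : Perm (Fin n) // ¬ PermContainsPattern v ![1, 2, 3] ∧ ¬ PermContainsPattern v ![2, 1, 3]} =
      2 ^ (n - 1) := by
  rw [← card_av123_av132_eq_card_av123_av213, card_av123_av132]

/-- PROPOSITION 7 with LEMMA 5 (a): `A_n(231, 321) = 2^{n−1}`. [cite: SimionSchmidt1985, Proposition 7 and Lemma 5 (a)
(held text p0010–p0011)] -/
theorem card_av231_av321 (n : ℕ) :
    Nat.card {v : Perm (Fin n) // ¬ PermContainsPattern v ![2, 3, 1] ∧ ¬ PermContainsPattern v ![3, 2, 1]} =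
      2 ^ (n - 1) := by
  rw [← card_av123_av132_eq_card_av231_av321, card_av123_av132]

/-- PROPOSITION 7 with LEMMA 5 (a): `A_n(312, 321) = 2^{n−1}`. [cite: SimionSchmidt1985, Proposition 7 and Lemma 5 (a)
(held text p0010–p0011)] -/
theorem card_av312_av321 (n : ℕ) :
    Nat.card {v : Perm (Fin n) // ¬ PermContainsPattern v ![3, 1, 2] ∧ ¬ PermContainsPattern v ![3, 2, 1]} =
      2 ^ (n - 1) := by
  rw [← card_av123_av132_eq_card_av312_av321, card_av123_av132]

end Prop7

/-! ### §2 PROPOSITION 8 — `A_n(132, 213) = 2^{n−1}` -/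

section Prop8

variable {α : Type*} [LinearOrder α]

/-- ★★ **Proposition 8 on words.** The arrangements of a finite set `S` with no `132`- and no `213`-sublist number
`2^{#S − 1}`: split at the largest letter `m`; `l₂` is an avoider on the `|l₂|` smallest letters and `l₁` INCREASES (a
descent of `l₁` followed by `m` is a `213`) — «`σ(i) = n − k + i` for `1 ≤ i ≤ k` is forced» — so `A_n` satisfies the
recurrence of Proposition 7. [cite: SimionSchmidt1985, Proposition 8 (held text p0011)] -/
theorem card_arrangements_not132_not213
    [DecidablePred fun l : List α => (¬ ∃ a b c : α, [a, b, c].Sublist l ∧ a < c ∧ c < b) ∧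
      ¬ ∃ a b c : α, [a, b, c].Sublist l ∧ b < a ∧ a < c] (S : Finset α) :
    ((Multiset.lists S.val).toFinset.filter (fun l => (¬ ∃ a b c : α, [a, b, c].Sublist l ∧ a < c ∧ c < b) ∧
      ¬ ∃ a b c : α, [a, b, c].Sublist l ∧ b < a ∧ a < c)).card = 2 ^ (S.card - 1) := by
  set av : Finset α → Finset (List α) := fun T => (Multiset.lists T.val).toFinset.filter
    (fun l => (¬ ∃ a b c : α, [a, b, c].Sublist l ∧ a < c ∧ c < b) ∧
      ¬ ∃ a b c : α, [a, b, c].Sublist l ∧ b < a ∧ a < c) with hav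
  have hmem_av : ∀ (T : Finset α) (l : List α), l ∈ av T ↔ (l.Nodup ∧ ∀ x, x ∈ l ↔ x ∈ T) ∧
      (¬ ∃ a b c : α, [a, b, c].Sublist l ∧ a < c ∧ c < b) ∧ ¬ ∃ a b c : α, [a, b, c].Sublist l ∧ b < a ∧ a < c :=
    fun T l => by simp only [hav, Finset.mem_filter, mem_lists_toFinset_iff]
  have hav_empty : av ∅ = {[]} := by
    simp only [hav, lists_toFinset_empty]
    rw [Finset.filter_singleton, if_pos ⟨by rintro ⟨a, b, c, h, -⟩; simp at h, by rintro ⟨a, b, c, h, -⟩; simp at h⟩]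
  change (av S).card = 2 ^ (S.card - 1)
  induction' hn : S.card using Nat.strong_induction_on with n ih generalizing S
  rcases n with _ | n
  · rw [Finset.card_eq_zero.mp hn, hav_empty, Finset.card_singleton]
    norm_num
  have hS : S.Nonempty := Finset.card_pos.mp (by omega)
  set m := S.max' hS with hm
  set S' := S.erase m with hS'def
  have hmS : m ∈ S := Finset.max'_mem S hS
  have hS' : S'.card = n := by rw [hS'def, Finset.card_erase_of_mem hmS, hn]; rfl
  have hltm : ∀ x ∈ S', x < m := fun x hx => Finset.lt_max'_of_mem_erase_max' S hS hx
  have hmemS : ∀ x, x ∈ S ↔ x = m ∨ x ∈ S' := fun x => by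
    rw [hS'def, Finset.mem_erase]
    constructor
    · intro hx
      by_cases h : x = m
      · exact Or.inl h
      · exact Or.inr ⟨h, hx⟩
    · rintro (rfl | ⟨-, hx⟩)
      · exact hmS
      · exact hx
  -- `low j` = the `j` smallest letters of `S'`; `inc j` = the others in increasing order
  set low : ℕ → Finset α := fun j => S'.filter (fun x => (S'.filter (· < x)).card < j) with hlow
  have hlow_card : ∀ j ≤ n, (low j).card = j := fun j hj => card_filter_rank_lt S' (by rw [hS']; exact hj)
  set inc : ℕ → List α := fun j => ((S' \ low j).sort : List α) with hinc
  have hinc_mem : ∀ j x, x ∈ inc j ↔ x ∈ S' \ low j := fun j x => by rw [hinc, Finset.mem_sort]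
  have hinc_nodup : ∀ j, (inc j).Nodup := fun j => Finset.sort_nodup _ _
  have hinc_lt : ∀ j, (inc j).Pairwise (· < ·) := fun j => (Finset.sortedLT_sort _).pairwise
  have hminc : ∀ j, m ∉ inc j := fun j h =>
    lt_irrefl m (hltm m (Finset.sdiff_subset ((hinc_mem j m).mp h)))
  -- the piece `j`: `inc j ++ m :: l₂`, `l₂` an avoider on `low j`
  have hpiece : ∀ j, ∀ l₂ ∈ av (low j), inc j ++ m :: l₂ ∈ av S := fun j l₂ hl₂ => by
    rw [hmem_av] at hl₂ ⊢
    obtain ⟨⟨hn₂, hmem₂⟩, h132, h213⟩ := hl₂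
    obtain ⟨hnd, hmem, hm₁, hm₂, hbelow⟩ := glue_at_max S' hltm j (hinc_nodup j) hn₂ hmem₂ (hinc_mem j)
    refine ⟨⟨hnd, fun x => by rw [hmem x, hmemS]⟩, ?_, ?_⟩
    · rw [has132_append_max_iff _ _ m hm₁ hm₂]
      rintro (h | h | ⟨x, hx, y, hy, hxy⟩)
      · exact not_has132_of_pairwise_lt (hinc_lt j) h
      · exact h132 h
      · exact absurd hxy (not_lt.mpr (hbelow x hx y hy).le)
    · rw [has213_append_max_iff _ _ m hm₁ hm₂]
      rintro (h | h | ⟨x, hx, b, c, hs, -, hxc⟩)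
      · exact h213 h
      · exact not_has21_of_pairwise_lt (hinc_lt j) h
      · exact absurd hxc (not_lt.mpr (hbelow x hx c (hs.subset (by simp))).le)
  have hsplit : ∀ l ∈ av S, ∃ j, j < n + 1 ∧ ∃ l₂ ∈ av (low j), inc j ++ m :: l₂ = l := fun l hl => by
    rw [hmem_av] at hl
    obtain ⟨⟨hnd, hmem⟩, h132, h213⟩ := hl
    obtain ⟨l₁, l₂, rfl, hn₁, hn₂, hlen, hmem₂, hmem₁, hm₁, hm₂, hbelow⟩ :=
      exists_split_at_max S' hltm hnd (fun x => by rw [hmem x, hmemS]) h132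
    rw [hS'] at hlen
    refine ⟨l₂.length, by omega, l₂, ?_, ?_⟩
    · rw [hmem_av]
      refine ⟨⟨hn₂, hmem₂⟩, fun ⟨a, b, c, hs, hh⟩ => h132 ⟨a, b, c, ?_, hh⟩, fun ⟨a, b, c, hs, hh⟩ =>
        h213 ⟨a, b, c, ?_, hh⟩⟩ <;>
      exact (hs.trans (List.sublist_cons_self m l₂)).trans (List.sublist_append_right l₁ (m :: l₂))
    · -- `l₁` increases: a descent `a b` of `l₁` gives the `213`-pattern `a b m`
      have hlt : l₁.Pairwise (· < ·) := pairwise_lt_of_not_has21 hn₁ fun ⟨a, b, hs, hba⟩ =>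
        h213 ((has213_append_max_iff l₁ l₂ m hm₁ hm₂).mpr (Or.inr (Or.inl ⟨a, b, hs, hba⟩)))
      rw [eq_sort_of_pairwise_lt hlt hmem₁]
  have hU : av S = (Finset.range (n + 1)).biUnion (fun j => (av (low j)).image fun l₂ => inc j ++ m :: l₂) := by
    ext l
    simp only [Finset.mem_biUnion, Finset.mem_range, Finset.mem_image]
    constructor
    · exact hsplit l
    · rintro ⟨j, -, l₂, hl₂, rfl⟩
      exact hpiece j l₂ hl₂
  rw [hU, Finset.card_biUnion]
  · rw [Finset.sum_congr rfl fun j hj => ?_, sum_range_succ_two_pow_pred, Nat.add_sub_cancel]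
    rw [Finset.mem_range] at hj
    rw [Finset.card_image_of_injective _ fun l l' h => List.cons_injective (List.append_cancel_left h)]
    exact ih j (by omega) (low j) (hlow_card j (by omega))
  · intro j hj j' hj' hne
    rw [Finset.mem_coe, Finset.mem_range] at hj hj'
    rw [Function.onFun, Finset.disjoint_left]
    intro l hl hl'
    rw [Finset.mem_image] at hl hl'
    obtain ⟨l₂, h₂, rfl⟩ := hl
    obtain ⟨l₂', h₂', he⟩ := hl'
    have e := (append_cons_inj_of_notMem' (hminc j') (hminc j) he).2
    rw [hmem_av] at h₂ h₂'
    have hl2 := length_eq_card_of_mem_iff' h₂.1.1 h₂.1.2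
    have hl2' := length_eq_card_of_mem_iff' h₂'.1.1 h₂'.1.2
    rw [hlow_card j (by omega)] at hl2
    rw [hlow_card j' (by omega), e, hl2] at hl2'
    exact hne hl2'

/-- ★★★ **PROPOSITION 8 (Simion–Schmidt 1985)** «For all `n ≥ 1`, `A_n(132, 213) = 2^{n−1}`» (stated for every `n`).
[cite: SimionSchmidt1985, Proposition 8 (held text p0011)] -/
theorem card_av132_av213 (n : ℕ) :
    Nat.card {v : Perm (Fin n) // ¬ PermContainsPattern v ![1, 3, 2] ∧ ¬ PermContainsPattern v ![2, 1, 3]} =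
      2 ^ (n - 1) := by
  classical
  refine (natCard_perm_eq_card_filter_arrangements n
    (fun v : Perm (Fin n) => ¬ PermContainsPattern v ![1, 3, 2] ∧ ¬ PermContainsPattern v ![2, 1, 3])
    (fun l : List ℕ => (¬ ∃ a b c : ℕ, [a, b, c].Sublist l ∧ a < c ∧ c < b) ∧
      ¬ ∃ a b c : ℕ, [a, b, c].Sublist l ∧ b < a ∧ a < c)
    (fun v => by rw [has132_ofFn_perm_iff, has213_ofFn_perm_iff])).trans ?_
  rw [card_arrangements_not132_not213 (α := ℕ) (Finset.range n), Finset.card_range]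

/-- PROPOSITION 8: «`A_n(132, 213)` satisfies the same recurrence and has the same initial values as `A_n(132, 123)`»
— in particular the two numbers agree. [cite: SimionSchmidt1985, Proposition 8 (proof, held text p0011)] -/
theorem card_av132_av213_eq_card_av123_av132 (n : ℕ) :
    Nat.card {v : Perm (Fin n) // ¬ PermContainsPattern v ![1, 3, 2] ∧ ¬ PermContainsPattern v ![2, 1, 3]} =
      Nat.card {v : Perm (Fin n) // ¬ PermContainsPattern v ![1, 2, 3] ∧ ¬ PermContainsPattern v ![1, 3, 2]} := by
  rw [card_av132_av213, card_av123_av132]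

/-- PROPOSITION 8 with LEMMA 5 (b): `A_n(231, 312) = 2^{n−1}`. [cite: SimionSchmidt1985, Proposition 8 and Lemma 5 (b)
(held text p0010–p0011)] -/
theorem card_av231_av312 (n : ℕ) :
    Nat.card {v : Perm (Fin n) // ¬ PermContainsPattern v ![2, 3, 1] ∧ ¬ PermContainsPattern v ![3, 1, 2]} =
      2 ^ (n - 1) := by
  rw [← card_av132_av213_eq_card_av231_av312, card_av132_av213]

end Prop8

/-! ### §3 PROPOSITION 10 — `A_n(132, 312) = 2^{n−1}` -/

section Prop10

variable {α : Type*} [LinearOrder α]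

/-- ★★ **Proposition 10 on words.** The arrangements of a finite set `S` with no `132`- and no `312`-sublist number
`2^{#S − 1}`: split at the largest letter `m`; `l₂` consists of the `|l₂|` smallest letters and DECREASES (`m` followed
by an ascent is a `312`) — «`σ(k + i) = n − k − i + 1`» — while `l₁` is any avoider on the other letters; so
`A_n = 1 + Σ_{k=2}^{n} A_{k−1} = 2^{n−1}`. [cite: SimionSchmidt1985, Proposition 10 (held text p0011)] -/
theorem card_arrangements_not132_not312
    [DecidablePred fun l : List α => (¬ ∃ a b c : α, [a, b, c].Sublist l ∧ a < c ∧ c < b) ∧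
      ¬ ∃ a b c : α, [a, b, c].Sublist l ∧ b < c ∧ c < a] (S : Finset α) :
    ((Multiset.lists S.val).toFinset.filter (fun l => (¬ ∃ a b c : α, [a, b, c].Sublist l ∧ a < c ∧ c < b) ∧
      ¬ ∃ a b c : α, [a, b, c].Sublist l ∧ b < c ∧ c < a)).card = 2 ^ (S.card - 1) := by
  set av : Finset α → Finset (List α) := fun T => (Multiset.lists T.val).toFinset.filter
    (fun l => (¬ ∃ a b c : α, [a, b, c].Sublist l ∧ a < c ∧ c < b) ∧
      ¬ ∃ a b c : α, [a, b, c].Sublist l ∧ b < c ∧ c < a) with hav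
  have hmem_av : ∀ (T : Finset α) (l : List α), l ∈ av T ↔ (l.Nodup ∧ ∀ x, x ∈ l ↔ x ∈ T) ∧
      (¬ ∃ a b c : α, [a, b, c].Sublist l ∧ a < c ∧ c < b) ∧ ¬ ∃ a b c : α, [a, b, c].Sublist l ∧ b < c ∧ c < a :=
    fun T l => by simp only [hav, Finset.mem_filter, mem_lists_toFinset_iff]
  have hav_empty : av ∅ = {[]} := by
    simp only [hav, lists_toFinset_empty]
    rw [Finset.filter_singleton, if_pos ⟨by rintro ⟨a, b, c, h, -⟩; simp at h, by rintro ⟨a, b, c, h, -⟩; simp at h⟩]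
  change (av S).card = 2 ^ (S.card - 1)
  induction' hn : S.card using Nat.strong_induction_on with n ih generalizing S
  rcases n with _ | n
  · rw [Finset.card_eq_zero.mp hn, hav_empty, Finset.card_singleton]
    norm_num
  have hS : S.Nonempty := Finset.card_pos.mp (by omega)
  set m := S.max' hS with hm
  set S' := S.erase m with hS'def
  have hmS : m ∈ S := Finset.max'_mem S hS
  have hS' : S'.card = n := by rw [hS'def, Finset.card_erase_of_mem hmS, hn]; rfl
  have hltm : ∀ x ∈ S', x < m := fun x hx => Finset.lt_max'_of_mem_erase_max' S hS hx
  have hmS' : m ∉ S' := fun h => lt_irrefl m (hltm m h)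
  have hmemS : ∀ x, x ∈ S ↔ x = m ∨ x ∈ S' := fun x => by
    rw [hS'def, Finset.mem_erase]
    constructor
    · intro hx
      by_cases h : x = m
      · exact Or.inl h
      · exact Or.inr ⟨h, hx⟩
    · rintro (rfl | ⟨-, hx⟩)
      · exact hmS
      · exact hx
  -- `low j` = the `j` smallest letters of `S'`, `dsc j` = them in decreasing order
  set low : ℕ → Finset α := fun j => S'.filter (fun x => (S'.filter (· < x)).card < j) with hlow
  have hlow_sub : ∀ j, low j ⊆ S' := fun j => Finset.filter_subset _ _
  have hlow_card : ∀ j ≤ n, (low j).card = j := fun j hj => card_filter_rank_lt S' (by rw [hS']; exact hj)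
  set dsc : ℕ → List α := fun j => ((low j).sort : List α).reverse with hdsc
  have hdsc_mem : ∀ j x, x ∈ dsc j ↔ x ∈ low j := fun j x => by
    rw [hdsc, List.mem_reverse, Finset.mem_sort]
  have hdsc_nodup : ∀ j, (dsc j).Nodup := fun j => List.nodup_reverse.mpr (Finset.sort_nodup _ _)
  have hdsc_gt : ∀ j, (dsc j).Pairwise (fun a b => b < a) := fun j => pairwise_gt_reverse_sort _
  have hdsc_len : ∀ j ≤ n, (dsc j).length = j := fun j hj => by
    rw [hdsc, List.length_reverse, Finset.length_sort, hlow_card j hj]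
  -- the piece `j`: `l₁ ++ m :: dsc j`, `l₁` an avoider on `S' \ low j`
  have hpiece : ∀ j, ∀ l₁ ∈ av (S' \ low j), l₁ ++ m :: dsc j ∈ av S := fun j l₁ hl₁ => by
    rw [hmem_av] at hl₁ ⊢
    obtain ⟨⟨hn₁, hmem₁⟩, h132, h312⟩ := hl₁
    obtain ⟨hnd, hmem, hm₁, hm₂, hbelow⟩ := glue_at_max S' hltm j hn₁ (hdsc_nodup j) (hdsc_mem j) hmem₁
    refine ⟨⟨hnd, fun x => by rw [hmem x, hmemS]⟩, ?_, ?_⟩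
    · rw [has132_append_max_iff _ _ m hm₁ hm₂]
      rintro (h | h | ⟨x, hx, y, hy, hxy⟩)
      · exact h132 h
      · exact not_has132_of_pairwise_gt (hdsc_gt j) h
      · exact absurd hxy (not_lt.mpr (hbelow x hx y hy).le)
    · rw [has312_append_max_iff _ _ m hm₁ hm₂]
      rintro (h | h | ⟨y, hy, a, b, hs, hby, -⟩)
      · exact h312 h
      · exact not_has12_of_pairwise_gt (hdsc_gt j) h
      · exact absurd hby (not_lt.mpr (hbelow b (hs.subset (by simp)) y hy).le)
  have hsplit : ∀ l ∈ av S, ∃ j, j < n + 1 ∧ ∃ l₁ ∈ av (S' \ low j), l₁ ++ m :: dsc j = l := fun l hl => by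
    rw [hmem_av] at hl
    obtain ⟨⟨hnd, hmem⟩, h132, h312⟩ := hl
    obtain ⟨l₁, l₂, rfl, hn₁, hn₂, hlen, hmem₂, hmem₁, hm₁, hm₂, hbelow⟩ :=
      exists_split_at_max S' hltm hnd (fun x => by rw [hmem x, hmemS]) h132
    rw [hS'] at hlen
    refine ⟨l₂.length, by omega, l₁, ?_, ?_⟩
    · rw [hmem_av]
      refine ⟨⟨hn₁, hmem₁⟩, fun ⟨a, b, c, hs, hh⟩ => h132 ⟨a, b, c, ?_, hh⟩, fun ⟨a, b, c, hs, hh⟩ =>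
        h312 ⟨a, b, c, ?_, hh⟩⟩ <;>
      exact hs.trans (List.sublist_append_left l₁ (m :: l₂))
    · -- `l₂` decreases: `m` followed by an ascent `a b` of `l₂` is a `312`
      have hgt : l₂.Pairwise (fun a b => b < a) := pairwise_gt_of_not_has12 hn₂ fun ⟨a, b, hs, hab⟩ =>
        h312 ((has312_append_max_iff l₁ l₂ m hm₁ hm₂).mpr (Or.inr (Or.inl ⟨a, b, hs, hab⟩)))
      rw [show dsc l₂.length = l₂ from (eq_reverse_sort_of_pairwise_gt hgt hmem₂).symm]
  have hU : av S = (Finset.range (n + 1)).biUnion (fun j => (av (S' \ low j)).image fun l₁ => l₁ ++ m :: dsc j) := by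
    ext l
    simp only [Finset.mem_biUnion, Finset.mem_range, Finset.mem_image]
    constructor
    · exact hsplit l
    · rintro ⟨j, -, l₁, hl₁, rfl⟩
      exact hpiece j l₁ hl₁
  rw [hU, Finset.card_biUnion]
  · have hrefl := Finset.sum_range_reflect (fun j => 2 ^ (j - 1)) (n + 1)
    simp only [Nat.add_sub_cancel] at hrefl
    rw [Finset.sum_congr rfl fun j hj => ?_, hrefl, sum_range_succ_two_pow_pred, Nat.add_sub_cancel]
    rw [Finset.mem_range] at hj
    rw [Finset.card_image_of_injective _ fun l l' h => List.append_cancel_right h]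
    exact ih (n - j) (by omega) (S' \ low j)
      (by rw [Finset.card_sdiff_of_subset (hlow_sub j), hS', hlow_card j (by omega)])
  · -- the pieces are disjoint: the part after `m` has `j` letters
    intro j hj j' hj' hne
    rw [Finset.mem_coe, Finset.mem_range] at hj hj'
    rw [Function.onFun, Finset.disjoint_left]
    intro l hl hl'
    rw [Finset.mem_image] at hl hl'
    obtain ⟨l₁, h₁, rfl⟩ := hl
    obtain ⟨l₁', h₁', he⟩ := hl'
    rw [hmem_av] at h₁ h₁'
    have hm₁ : m ∉ l₁ := fun h => hmS' (Finset.sdiff_subset ((h₁.1.2 m).mp h))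
    have hm₁' : m ∉ l₁' := fun h => hmS' (Finset.sdiff_subset ((h₁'.1.2 m).mp h))
    have e := congrArg List.length (append_cons_inj_of_notMem' hm₁' hm₁ he).2
    rw [hdsc_len j' (by omega), hdsc_len j (by omega)] at e
    exact hne e.symm

/-- ★★★ **PROPOSITION 10 (Simion–Schmidt 1985)** «For all `n ≥ 1`, `A_n(132, 312) = 2^{n−1}`» (stated for every
`n`). [cite: SimionSchmidt1985, Proposition 10 (held text p0011)] -/
theorem card_av132_av312 (n : ℕ) :
    Nat.card {v : Perm (Fin n) // ¬ PermContainsPattern v ![1, 3, 2] ∧ ¬ PermContainsPattern v ![3, 1, 2]} =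
      2 ^ (n - 1) := by
  classical
  refine (natCard_perm_eq_card_filter_arrangements n
    (fun v : Perm (Fin n) => ¬ PermContainsPattern v ![1, 3, 2] ∧ ¬ PermContainsPattern v ![3, 1, 2])
    (fun l : List ℕ => (¬ ∃ a b c : ℕ, [a, b, c].Sublist l ∧ a < c ∧ c < b) ∧
      ¬ ∃ a b c : ℕ, [a, b, c].Sublist l ∧ b < c ∧ c < a)
    (fun v => by rw [has132_ofFn_perm_iff, has312_ofFn_perm_iff])).trans ?_
  rw [card_arrangements_not132_not312 (α := ℕ) (Finset.range n), Finset.card_range]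

/-- PROPOSITION 10 with LEMMA 5 (d): `A_n(213, 231) = 2^{n−1}`. [cite: SimionSchmidt1985, Proposition 10 and Lemma 5
(d) (held text p0010–p0011)] -/
theorem card_av213_av231 (n : ℕ) :
    Nat.card {v : Perm (Fin n) // ¬ PermContainsPattern v ![2, 1, 3] ∧ ¬ PermContainsPattern v ![2, 3, 1]} =
      2 ^ (n - 1) := by
  rw [← card_av132_av312_eq_card_av213_av231, card_av132_av312]

end Prop10

/-! ### §4 The pair `(123, 321)`: no avoiders from length `5` on -/

section Pair123321

variable {α : Type*} [LinearOrder α]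

/-- ★ «`A_n(R) = 0` (case `R = {123, 321}`, for `n ≥ 5`)» on words: an arrangement of `≥ 5` letters has a `123`- or a
`321`-sublist.  Split at the largest letter `m`: the letters before `m` decrease, those after increase; three letters on
one side give a monotone triple, and `2 + 2` letters `x y m z w` give `y z w` (`y < z`) or `x y z` (`z < y`).
[cite: SimionSchmidt1985, §3, summary before Proposition 7 (held text p0010)] -/
theorem has123_or_has321_of_five_le {l : List α} (hnd : l.Nodup) (h5 : 5 ≤ l.length) :
    (∃ a b c : α, [a, b, c].Sublist l ∧ a < b ∧ b < c) ∨ ∃ a b c : α, [a, b, c].Sublist l ∧ c < b ∧ b < a := by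
  by_contra hcon
  rw [not_or] at hcon
  obtain ⟨h123, h321⟩ := hcon
  have hS : l.toFinset.Nonempty := by
    rw [List.toFinset_nonempty_iff]
    rintro rfl
    simp at h5
  -- the largest letter `m` and the split `l = l₁ m l₂`
  obtain ⟨m, hml, hle⟩ : ∃ m ∈ l, ∀ x ∈ l, x ≤ m :=
    ⟨l.toFinset.max' hS, List.mem_toFinset.mp (Finset.max'_mem _ hS),
      fun x hx => Finset.le_max' _ x (List.mem_toFinset.mpr hx)⟩
  obtain ⟨l₁, l₂, rfl⟩ := List.append_of_mem hml
  have hnd' := hnd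
  rw [List.nodup_append] at hnd'
  obtain ⟨hn₁, hn₂', hdis⟩ := hnd'
  rw [List.nodup_cons] at hn₂'
  obtain ⟨hm₂, hn₂⟩ := hn₂'
  have hm₁ : m ∉ l₁ := fun h => (hdis m h m List.mem_cons_self) rfl
  have hlt₁ : ∀ x ∈ l₁, x < m := fun x hx =>
    lt_of_le_of_ne (hle x (List.mem_append.mpr (Or.inl hx))) fun h => hm₁ (h ▸ hx)
  have hlt₂ : ∀ y ∈ l₂, y < m := fun y hy =>
    lt_of_le_of_ne (hle y (List.mem_append.mpr (Or.inr (List.mem_cons_of_mem m hy)))) fun h => hm₂ (h ▸ hy)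
  -- before `m` the letters decrease (no `a b m`), after `m` they increase (no `m b c`)
  have hgt : l₁.Pairwise (fun a b => b < a) := pairwise_gt_of_not_has12 hn₁ fun ⟨a, b, hs, hab⟩ =>
    h123 ((has123_append_max_iff l₁ l₂ m hlt₁ hlt₂).mpr (Or.inr (Or.inl ⟨a, b, hs, hab⟩)))
  have hlt : l₂.Pairwise (· < ·) := pairwise_lt_of_not_has21 hn₂ fun ⟨b, c, hs, hcb⟩ =>
    h321 ((has321_append_max_iff l₁ l₂ m hlt₁ hlt₂).mpr (Or.inr (Or.inl ⟨b, c, hs, hcb⟩)))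
  -- at most two letters on each side
  have hlen₁ : l₁.length ≤ 2 := by
    by_contra hlen
    rcases l₁ with _ | ⟨a, _ | ⟨b, _ | ⟨c, t⟩⟩⟩ <;> simp at hlen
    have hab : b < a := List.pairwise_iff_forall_sublist.mp hgt
      (List.cons_sublist_cons.mpr (List.cons_sublist_cons.mpr (List.nil_sublist _)))
    have hbc : c < b := List.pairwise_iff_forall_sublist.mp hgt
      ((List.cons_sublist_cons.mpr (List.cons_sublist_cons.mpr (List.nil_sublist _))).cons a)
    refine h321 ⟨a, b, c, ?_, hbc, hab⟩
    exact (List.cons_sublist_cons.mpr (List.cons_sublist_cons.mpr (List.cons_sublist_cons.mpr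
      (List.nil_sublist t)))).trans (List.sublist_append_left _ _)
  have hlen₂ : l₂.length ≤ 2 := by
    by_contra hlen
    rcases l₂ with _ | ⟨a, _ | ⟨b, _ | ⟨c, t⟩⟩⟩ <;> simp at hlen
    have hab : a < b := List.pairwise_iff_forall_sublist.mp hlt
      (List.cons_sublist_cons.mpr (List.cons_sublist_cons.mpr (List.nil_sublist _)))
    have hbc : b < c := List.pairwise_iff_forall_sublist.mp hlt
      ((List.cons_sublist_cons.mpr (List.cons_sublist_cons.mpr (List.nil_sublist _))).cons a)
    refine h123 ⟨a, b, c, ?_, hab, hbc⟩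
    exact ((List.cons_sublist_cons.mpr (List.cons_sublist_cons.mpr (List.cons_sublist_cons.mpr
      (List.nil_sublist t)))).trans (List.sublist_cons_self m _)).trans (List.sublist_append_right l₁ _)
  have hlen : l₁.length = 2 ∧ l₂.length = 2 := by
    simp only [List.length_append, List.length_cons] at h5
    omega
  obtain ⟨x, y, rfl⟩ := List.length_eq_two.mp hlen.1
  obtain ⟨z, w, rfl⟩ := List.length_eq_two.mp hlen.2
  -- `x > y`, `z < w`; then `y z w` is a `123` or `x y z` is a `321`
  have hyx : y < x := List.pairwise_iff_forall_sublist.mp hgt (List.Sublist.refl _)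
  have hzw : z < w := List.pairwise_iff_forall_sublist.mp hlt (List.Sublist.refl _)
  have hyz : y ≠ z := hdis y (by simp) z (by simp)
  rcases lt_or_gt_of_ne hyz with h | h
  · exact h123 ⟨y, z, w, ((List.sublist_cons_self m [z, w]).cons_cons y).cons x, h, hzw⟩
  · exact h321 ⟨x, y, z, ((List.singleton_sublist.mpr (by simp)).cons_cons y).cons_cons x, h, hyx⟩

/-- «`A_n(R) = 0` (case `R = {123, 321}`, for `n ≥ 5`)» on words: no arrangement of `≥ 5` letters avoids both `123` and
`321`. [cite: SimionSchmidt1985, §3, summary before Proposition 7 (held text p0010)] -/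
theorem card_arrangements_not123_not321_eq_zero
    [DecidablePred fun l : List α => (¬ ∃ a b c : α, [a, b, c].Sublist l ∧ a < b ∧ b < c) ∧
      ¬ ∃ a b c : α, [a, b, c].Sublist l ∧ c < b ∧ b < a] (S : Finset α) (h5 : 5 ≤ S.card) :
    ((Multiset.lists S.val).toFinset.filter (fun l => (¬ ∃ a b c : α, [a, b, c].Sublist l ∧ a < b ∧ b < c) ∧
      ¬ ∃ a b c : α, [a, b, c].Sublist l ∧ c < b ∧ b < a)).card = 0 := by
  rw [Finset.card_eq_zero, Finset.filter_eq_empty_iff]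
  intro l hl h
  have hlen := length_of_mem_lists_toFinset hl
  rcases has123_or_has321_of_five_le ((mem_lists_toFinset_iff S l).mp hl).1 (by rw [hlen]; exact h5) with h' | h'
  · exact h.1 h'
  · exact h.2 h'

/-- ★★ **The pair `(123, 321)`** «`A_n(R) = 0` (case `R = {123, 321}`, for `n ≥ 5`)»: no permutation of length `n ≥ 5`
avoids both `123` and `321`. [cite: SimionSchmidt1985, §3, summary before Proposition 7 (held text p0010)] -/
theorem card_av123_av321_eq_zero (n : ℕ) (hn : 5 ≤ n) :
    Nat.card {v : Perm (Fin n) // ¬ PermContainsPattern v ![1, 2, 3] ∧ ¬ PermContainsPattern v ![3, 2, 1]} = 0 := by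
  classical
  refine (natCard_perm_eq_card_filter_arrangements n
    (fun v : Perm (Fin n) => ¬ PermContainsPattern v ![1, 2, 3] ∧ ¬ PermContainsPattern v ![3, 2, 1])
    (fun l : List ℕ => (¬ ∃ a b c : ℕ, [a, b, c].Sublist l ∧ a < b ∧ b < c) ∧
      ¬ ∃ a b c : ℕ, [a, b, c].Sublist l ∧ c < b ∧ b < a)
    (fun v => by rw [has123_ofFn_perm_iff, has321_ofFn_perm_iff])).trans ?_
  exact card_arrangements_not123_not321_eq_zero (α := ℕ) (Finset.range n) (by rw [Finset.card_range]; exact hn)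

/-- Equivalently: every permutation of length `n ≥ 5` contains `123` or `321` (the case `3 × 3` of Erdős–Szekeres).
[cite: SimionSchmidt1985, §3, summary before Proposition 7 (held text p0010)] -/
theorem contains_123_or_321_of_five_le {n : ℕ} (hn : 5 ≤ n) (v : Perm (Fin n)) :
    PermContainsPattern v ![1, 2, 3] ∨ PermContainsPattern v ![3, 2, 1] := by
  have h := has123_or_has321_of_five_le (l := List.ofFn fun i => (v i : ℕ))
    (List.nodup_ofFn.mpr (Fin.val_injective.comp v.injective)) (by rw [List.length_ofFn]; exact hn)
  rcases h with h | h
  · exact Or.inl ((has123_ofFn_perm_iff v).mp h)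
  · exact Or.inr ((has321_ofFn_perm_iff v).mp h)

/-- The bound `5` is sharp: `2 1 4 3 ∈ S_4` avoids both `123` and `321` (so `A_4(123, 321) ≠ 0`).
[cite: SimionSchmidt1985, §3, summary before Proposition 7 (held text p0010)] -/
theorem card_av123_av321_four_ne_zero :
    Nat.card {v : Perm (Fin 4) // ¬ PermContainsPattern v ![1, 2, 3] ∧ ¬ PermContainsPattern v ![3, 2, 1]} ≠ 0 := by
  rw [Nat.card_ne_zero]
  refine ⟨⟨⟨Equiv.swap 0 1 * Equiv.swap 2 3, ?_, ?_⟩⟩, inferInstance⟩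
  · rw [contains_123_iff]
    rintro ⟨i, j, k, hij, hjk, h1, h2⟩
    fin_cases i <;> fin_cases j <;> fin_cases k <;> revert hij hjk h1 h2 <;> decide
  · rw [contains_321_iff]
    rintro ⟨i, j, k, hij, hjk, h1, h2⟩
    fin_cases i <;> fin_cases j <;> fin_cases k <;> revert hij hjk h1 h2 <;> decide

end Pair123321

end PermContainsPattern

end Literature.Combinatorics.Enumerative
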